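import Summits.Parity.BatemanHorn.Theorems.SoloInformedGeneralPolynomialSplit
import Literature.NumberTheory.Sieve.LargestPrimeFactorCubicLocal

/-!
# SoloInformedDivisorPairingStorey — the divisor problem along one polynomial is, up to `O(x)`, an explicit small-divisor term plus a LOCATED ROOT COUNT past `x`

Solo unit `solo-Parity-informed` (ideation tier, informed mode), session 136; `PLAN.md` §101, CLAIMS C209;
deliverable `paper/SHARPEST-STATEMENT.md` §4 row 4 (the `d ≥ 3` rung below the wall) and `paper/paper.md`
Remark 20.29, whose structural sentence this file makes kernel-checked.

Let `g ∈ ℤ[X]` and write `N(n) = |g(n)|`, `τ` = number of divisors, `ρ_g(d) = #{ν mod d : g(ν) ≡ 0}`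
(`polyRootCountMod ![g] d`).  Three elementary facts, valid for every `g`:

* **divisor pairing** (`card_divisors_eq_two_mul_add_sq`): `τ(N) = 2·#{d ∣ N : d² < N} + #{d ∣ N : d² = N}`
  (the involution `d ↦ N/d`);
* **storey split at `x`** (`card_lt_add_bdry_eq`): for each `n`,
  `#{d ∣ N : d² < N} + Bdry = #{d ∣ N : d ≤ x} + #{d ∣ N : x < d, d² < N}`, where the boundary term
  `Bdry = #{d ∣ N : d ≤ x, N ≤ d²}` only sees `n` with `N(n) ≤ x²`;
* **swap** (`smallStorey_eq_sum_card`): `∑_{n ≤ x} #{d ∣ N(n) : d ≤ x} = ∑_{d ≤ x} #{n ≤ x : d ∣ g(n)}`, and each class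
  count is `x ρ_g(d)/d + O(ρ_g(d))` (the tree's `abs_card_filter_dvd_eval_sub_le`).

Hence (`abs_polyDivisorSum_sub_main_sub_located_le`), for every `g` with `n² ≤ |g(n)|` for `n ≥ 1` (e.g. `n³ + 2`,
`n² + 1`; the hypothesis makes the boundary term `≤ 2∑_{d ≤ x} ρ_g(d)`):

  `|S_g(x) − 2x·L_g(x) − 2·Mid_g(x)| ≤ x + 6·∑_{d ≤ x} ρ_g(d)`,

  `S_g(x) := ∑_{n ≤ x} τ(|g(n)|)`,  `L_g(x) := ∑_{d ≤ x} ρ_g(d)/d`,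
  `Mid_g(x) := #{(n, e) : n ≤ x, e ∣ g(n), x < e, e² < |g(n)|}` — the LOCATED ROOT COUNT: roots `n ∈ [1, x]` of
  `g mod e` for moduli `e` PAST `x` (scale `x/e < 1`), up to `e < |g(n)|^{1/2} ≍ x^{d/2}`;

and for `g` irreducible of positive degree the tree's first moment `∑_{d ≤ x} ρ_g(d) ≤ C x`
(`exists_sum_rootCount_le`, Hall–Tenenbaum) gives the headline

  **`S_g(x) = 2x·L_g(x) + 2·Mid_g(x) + O_g(x)`**   (`exists_abs_polyDivisorSum_sub_le`; for `g = X³ + 2`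
  unconditionally, `exists_abs_polyDivisorSum_cubic_sub_le`),

and, granted the classical mean value `L_g(x) = A_g log x + O(1)` (Dedekind–Landau; a hypothesis here, not proved
in this file), `S_g(x) − 2·Mid_g(x) = 2A_g·x log x + O(x)` (`exists_abs_polyDivisorSum_sub_located_sub_log_le`): an
asymptotic `S_g(x) ~ D·x log x` is EQUIVALENT to `Mid_g(x) ~ (D/2 − A_g)·x log x`.  For `deg g = 2` the located
window `(x, |g(n)|^{1/2})` is a boundary layer (`Mid = O(x)`; the divisor problem for quadratics is elementary in this
sense); for `deg g = d ≥ 3` it is the range of moduli `(x, x^{d/2})`, and the expected value of `Mid_g` is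
`(d/2 − 1)A_g·x log x` — Erdős (1952) proved `S_g(x) ≍ x log x`, and no asymptotic is in print for any irreducible
`g` of degree `≥ 3`.  This is the parity-FREE sibling, one storey below, of the kernel headline of
`SoloInformedBatemanHornLocalisation` (`BH ⟺` Möbius cancellation over the divisors `e > x^{1−ε}`): already with the
weight `+1` in place of `μ(e)`, everything past the modulus scale `x` is an open located-root-count problem.
Numerically (HOME `work/s127`, kit job j347463, `g = n³ + 2`, `x = 2·10⁶`): `A_g = 0.50740`, `S_g(x)/(3A_g x log x) = 1.025`.
No bearing on the truth of the conjecture; bookkeeping for the deliverable's §4 row 4.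
-/

namespace Summit.Parity.BatemanHorn.Theorems

open Finset Polynomial
open Literature.NumberTheory.Sieve (polyRootCountMod exists_sum_rootCount_le)

/-! ### Divisor pairing for one natural number -/

/-- For `d ∣ N ≠ 0`: `d·d < N ↔ N < (N/d)·(N/d)`. -/
theorem mul_self_lt_iff_lt_div_mul_div {N d : ℕ} (hN : N ≠ 0) (hd : d ∣ N) :
    d * d < N ↔ N < N / d * (N / d) := by
  obtain ⟨e, rfl⟩ := hd
  have hd0 : 0 < d := Nat.pos_of_ne_zero fun h => hN (by simp [h])
  have he0 : 0 < e := Nat.pos_of_ne_zero fun h => hN (by simp [h])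
  rw [Nat.mul_div_cancel_left e hd0]
  constructor
  · intro h
    have hde : d < e := by
      by_contra hle
      push Not at hle
      exact absurd (Nat.mul_le_mul_left d hle) (not_le.mpr h)
    nlinarith
  · intro h
    have hde : d < e := by
      by_contra hle
      push Not at hle
      exact absurd (Nat.mul_le_mul_right e hle) (not_le.mpr h)
    nlinarith

/-- **Divisor pairing**: `#{d ∣ N : d² < N} = #{d ∣ N : N < d²}` via `d ↦ N/d`. -/
theorem card_divisors_filter_sq_lt_eq_card_sq_gt (N : ℕ) :
    #(N.divisors.filter fun d => d * d < N) = #(N.divisors.filter fun d => N < d * d) := by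
  rcases eq_or_ne N 0 with rfl | hN
  · simp
  refine Finset.card_bij' (fun d _ => N / d) (fun e _ => N / e) ?_ ?_ ?_ ?_
  · intro d hd
    simp only [mem_filter, Nat.mem_divisors] at hd ⊢
    exact ⟨⟨Nat.div_dvd_of_dvd hd.1.1, hN⟩, (mul_self_lt_iff_lt_div_mul_div hN hd.1.1).mp hd.2⟩
  · intro e he
    simp only [mem_filter, Nat.mem_divisors] at he ⊢
    refine ⟨⟨Nat.div_dvd_of_dvd he.1.1, hN⟩, ?_⟩
    rw [mul_self_lt_iff_lt_div_mul_div hN (Nat.div_dvd_of_dvd he.1.1), Nat.div_div_self he.1.1 hN]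
    exact he.2
  · intro d hd
    simp only [mem_filter, Nat.mem_divisors] at hd
    exact Nat.div_div_self hd.1.1 hN
  · intro e he
    simp only [mem_filter, Nat.mem_divisors] at he
    exact Nat.div_div_self he.1.1 hN

/-- **`τ(N) = 2·#{d ∣ N : d² < N} + #{d ∣ N : d² = N}`** (also for `N = 0`, where every term vanishes). -/
theorem card_divisors_eq_two_mul_add_sq (N : ℕ) :
    #N.divisors = 2 * #(N.divisors.filter fun d => d * d < N) + #(N.divisors.filter fun d => d * d = N) := by
  have h1 := card_filter_add_card_filter_not (s := N.divisors) (fun d => d * d < N)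
  have h2 := card_filter_add_card_filter_not
    (s := N.divisors.filter fun d => ¬ d * d < N) (fun d => d * d = N)
  have h3 : (N.divisors.filter fun d => ¬ d * d < N).filter (fun d => d * d = N)
      = N.divisors.filter fun d => d * d = N := by
    rw [filter_filter]
    exact filter_congr fun d _ => ⟨fun h => h.2, fun h => ⟨by omega, h⟩⟩
  have h4 : (N.divisors.filter fun d => ¬ d * d < N).filter (fun d => ¬ d * d = N)
      = N.divisors.filter fun d => N < d * d := by
    rw [filter_filter]
    exact filter_congr fun d _ => by omega
  rw [h3, h4, ← card_divisors_filter_sq_lt_eq_card_sq_gt] at h2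
  omega

/-- At most one divisor has `d² = N`. -/
theorem card_divisors_filter_sq_eq_le_one (N : ℕ) :
    #(N.divisors.filter fun d => d * d = N) ≤ 1 := by
  refine card_le_one.mpr fun a ha b hb => ?_
  simp only [mem_filter] at ha hb
  exact Nat.mul_self_inj.mp (ha.2.trans hb.2.symm)

/-- **Storey split at `x`** for one `N`:
`#{d ∣ N : d² < N} + #{d ∣ N : d ≤ x, N ≤ d²} = #{d ∣ N : d ≤ x} + #{d ∣ N : x < d, d² < N}`. -/
theorem card_lt_add_bdry_eq (N x : ℕ) :
    #(N.divisors.filter fun d => d * d < N) + #(N.divisors.filter fun d => d ≤ x ∧ N ≤ d * d)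
      = #(N.divisors.filter fun d => d ≤ x) + #(N.divisors.filter fun d => x < d ∧ d * d < N) := by
  have h1 := card_filter_add_card_filter_not
    (s := N.divisors.filter fun d => d * d < N) (fun d => d ≤ x)
  have h2 := card_filter_add_card_filter_not
    (s := N.divisors.filter fun d => d ≤ x) (fun d => d * d < N)
  have e1 : (N.divisors.filter fun d => d * d < N).filter (fun d => d ≤ x)
      = (N.divisors.filter fun d => d ≤ x).filter (fun d => d * d < N) := by
    rw [filter_filter, filter_filter]
    exact filter_congr fun d _ => and_comm
  have e2 : (N.divisors.filter fun d => d * d < N).filter (fun d => ¬ d ≤ x)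
      = N.divisors.filter fun d => x < d ∧ d * d < N := by
    rw [filter_filter]
    exact filter_congr fun d _ => by omega
  have e3 : (N.divisors.filter fun d => d ≤ x).filter (fun d => ¬ d * d < N)
      = N.divisors.filter fun d => d ≤ x ∧ N ≤ d * d := by
    rw [filter_filter]
    exact filter_congr fun d _ => by omega
  rw [e1, e2] at h1
  rw [e3] at h2
  omega

/-! ### The sums along the values of `g` -/

/-- `S_g(x) = ∑_{1 ≤ n ≤ x} τ(|g(n)|)`. -/
def polyDivisorSum (g : ℤ[X]) (x : ℕ) : ℕ :=
  ∑ n ∈ Icc 1 x, #((g.eval (n : ℤ)).natAbs.divisors)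

/-- The LOCATED ROOT COUNT `Mid_g(x) = #{(n, e) : 1 ≤ n ≤ x, e ∣ g(n), x < e, e² < |g(n)|}`: roots `n ≤ x` of `g`
modulo moduli `e` past `x`. -/
def polyLocatedRootCount (g : ℤ[X]) (x : ℕ) : ℕ :=
  ∑ n ∈ Icc 1 x, #(((g.eval (n : ℤ)).natAbs.divisors).filter fun e => x < e ∧ e * e < (g.eval (n : ℤ)).natAbs)

/-- The small storey `∑_{n ≤ x} #{d ∣ g(n) : d ≤ x}`. -/
def polySmallStorey (g : ℤ[X]) (x : ℕ) : ℕ :=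
  ∑ n ∈ Icc 1 x, #(((g.eval (n : ℤ)).natAbs.divisors).filter fun d => d ≤ x)

/-- The boundary term `∑_{n ≤ x} #{d ∣ g(n) : d ≤ x, |g(n)| ≤ d²}` (only `n` with `|g(n)| ≤ x²` contribute). -/
def polyBdryCount (g : ℤ[X]) (x : ℕ) : ℕ :=
  ∑ n ∈ Icc 1 x, #(((g.eval (n : ℤ)).natAbs.divisors).filter fun d => d ≤ x ∧ (g.eval (n : ℤ)).natAbs ≤ d * d)

/-- The square term `∑_{n ≤ x} #{d ∣ g(n) : d² = |g(n)|} ≤ x`. -/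
def polySqCount (g : ℤ[X]) (x : ℕ) : ℕ :=
  ∑ n ∈ Icc 1 x, #(((g.eval (n : ℤ)).natAbs.divisors).filter fun d => d * d = (g.eval (n : ℤ)).natAbs)

/-- `L_g(x) = ∑_{d ≤ x} ρ_g(d)/d`. -/
noncomputable def polySmallLevel (g : ℤ[X]) (x : ℕ) : ℝ :=
  ∑ d ∈ Icc 1 x, (polyRootCountMod ![g] d : ℝ) / d

/-- **The exact decomposition**: `S_g(x) + 2·Bdry_g(x) = 2·A_g(x) + 2·Mid_g(x) + Sq_g(x)`. -/
theorem polyDivisorSum_add_two_mul_bdry_eq (g : ℤ[X]) (x : ℕ) :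
    polyDivisorSum g x + 2 * polyBdryCount g x
      = 2 * polySmallStorey g x + 2 * polyLocatedRootCount g x + polySqCount g x := by
  unfold polyDivisorSum polyBdryCount polySmallStorey polyLocatedRootCount polySqCount
  rw [mul_sum, mul_sum, mul_sum, ← sum_add_distrib, ← sum_add_distrib, ← sum_add_distrib]
  refine sum_congr rfl fun n _ => ?_
  have h1 := card_divisors_eq_two_mul_add_sq (g.eval (n : ℤ)).natAbs
  have h2 := card_lt_add_bdry_eq (g.eval (n : ℤ)).natAbs x
  omega

/-- `Sq_g(x) ≤ x`. -/
theorem polySqCount_le (g : ℤ[X]) (x : ℕ) : polySqCount g x ≤ x := by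
  unfold polySqCount
  calc ∑ n ∈ Icc 1 x, #(((g.eval (n : ℤ)).natAbs.divisors).filter fun d => d * d = (g.eval (n : ℤ)).natAbs)
      ≤ ∑ _n ∈ Icc 1 x, 1 := sum_le_sum fun n _ => card_divisors_filter_sq_eq_le_one _
    _ = x := by simp

/-- **Swap**: the small storey is `∑_{d ≤ x} #{1 ≤ n ≤ x : d ∣ g(n)}` when `g` has no zero in `[1, x]`. -/
theorem polySmallStorey_eq_sum_card (g : ℤ[X]) {x : ℕ} (hg0 : ∀ n ∈ Icc 1 x, g.eval (n : ℤ) ≠ 0) :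
    polySmallStorey g x = ∑ d ∈ Icc 1 x, #((Icc 1 x).filter fun n : ℕ => (d : ℤ) ∣ g.eval (n : ℤ)) := by
  unfold polySmallStorey
  have h1 : ∀ n ∈ Icc 1 x, #(((g.eval (n : ℤ)).natAbs.divisors).filter fun d => d ≤ x)
      = ∑ d ∈ Icc 1 x, if (d : ℤ) ∣ g.eval (n : ℤ) then 1 else 0 := by
    intro n hn
    rw [divisors_filter_le_eq_Icc_filter (Int.natAbs_ne_zero.mpr (hg0 n hn)) x, card_filter]
    refine sum_congr rfl fun d _ => ?_
    simp only [Int.natCast_dvd]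
  rw [sum_congr rfl h1, sum_comm]
  refine sum_congr rfl fun d _ => ?_
  rw [card_filter]

/-- **The small storey is `x·L_g(x) + O(∑_{d ≤ x} ρ_g(d))`.** -/
theorem abs_polySmallStorey_sub_le (g : ℤ[X]) {x : ℕ} (hg0 : ∀ n ∈ Icc 1 x, g.eval (n : ℤ) ≠ 0) :
    |(polySmallStorey g x : ℝ) - (x : ℝ) * polySmallLevel g x|
      ≤ ∑ d ∈ Icc 1 x, (polyRootCountMod ![g] d : ℝ) := by
  rw [polySmallStorey_eq_sum_card g hg0, polySmallLevel, Nat.cast_sum, mul_sum, ← sum_sub_distrib]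
  refine (abs_sum_le_sum_abs _ _).trans (sum_le_sum fun d hd => ?_)
  have hd0 : 0 < d := (mem_Icc.mp hd).1
  have := abs_card_filter_dvd_eval_sub_le g hd0 x
  rwa [mul_div_assoc] at this

/-- **The boundary term is `≤ 2∑_{d ≤ x} ρ_g(d)`** when `n² ≤ |g(n)|` on `[1, x]`: then `|g(n)| ≤ d²` forces `n ≤ d`,
so for each `d ≤ x` only the roots `n ∈ [1, d]` — at most `2ρ_g(d)` of them — are counted. -/
theorem polyBdryCount_le (g : ℤ[X]) {x : ℕ} (hsq : ∀ n ∈ Icc 1 x, n * n ≤ (g.eval (n : ℤ)).natAbs) :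
    (polyBdryCount g x : ℝ) ≤ 2 * ∑ d ∈ Icc 1 x, (polyRootCountMod ![g] d : ℝ) := by
  have hg0 : ∀ n ∈ Icc 1 x, g.eval (n : ℤ) ≠ 0 := by
    intro n hn h
    have := hsq n hn
    rw [h, Int.natAbs_zero] at this
    have h1 : 1 ≤ n := (mem_Icc.mp hn).1
    nlinarith
  -- Step 1: an integer inequality, by swapping the sums.
  have hstep : polyBdryCount g x ≤ ∑ d ∈ Icc 1 x, #((Icc 1 d).filter fun n : ℕ => (d : ℤ) ∣ g.eval (n : ℤ)) := by
    unfold polyBdryCount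
    have h1 : ∀ n ∈ Icc 1 x,
        #(((g.eval (n : ℤ)).natAbs.divisors).filter fun d => d ≤ x ∧ (g.eval (n : ℤ)).natAbs ≤ d * d)
          ≤ ∑ d ∈ Icc 1 x, if (n ≤ d ∧ (d : ℤ) ∣ g.eval (n : ℤ)) then 1 else 0 := by
      intro n hn
      rw [← card_filter]
      refine card_le_card_of_injOn (fun d => d) (fun d hd => ?_) (Set.injOn_id _)
      simp only [coe_filter, Nat.mem_divisors, mem_Icc, Set.mem_setOf_eq] at hd ⊢
      obtain ⟨⟨hdN, hN⟩, hdx, hNd⟩ := hd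
      refine ⟨⟨Nat.pos_of_dvd_of_pos hdN (Nat.pos_of_ne_zero hN), hdx⟩, ?_, Int.natCast_dvd.mpr hdN⟩
      exact Nat.mul_self_le_mul_self_iff.mp ((hsq n hn).trans hNd)
    refine (sum_le_sum h1).trans ?_
    rw [sum_comm]
    refine sum_le_sum fun d hd => ?_
    rw [← card_filter]
    refine card_le_card_of_injOn (fun n => n) (fun n hn => ?_) (Set.injOn_id _)
    simp only [coe_filter, mem_Icc, Set.mem_setOf_eq] at hn ⊢
    exact ⟨⟨hn.1.1, hn.2.1⟩, hn.2.2⟩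
  -- Step 2: each class count on `[1, d]` is at most `2ρ_g(d)`.
  calc (polyBdryCount g x : ℝ)
      ≤ ∑ d ∈ Icc 1 x, (#((Icc 1 d).filter fun n : ℕ => (d : ℤ) ∣ g.eval (n : ℤ)) : ℝ) := by
        exact_mod_cast hstep
    _ ≤ ∑ d ∈ Icc 1 x, 2 * (polyRootCountMod ![g] d : ℝ) := by
        refine sum_le_sum fun d hd => ?_
        have hd0 : 0 < d := (mem_Icc.mp hd).1
        have h := abs_card_filter_dvd_eval_sub_le g hd0 d
        have hdd : (d : ℝ) * (polyRootCountMod ![g] d : ℝ) / d = polyRootCountMod ![g] d := by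
          field_simp
        rw [hdd] at h
        have := (abs_sub_le_iff.mp h).1
        linarith
    _ = 2 * ∑ d ∈ Icc 1 x, (polyRootCountMod ![g] d : ℝ) := by rw [mul_sum]

/-- **Main inequality (every `g` with `n² ≤ |g(n)|` on `[1, x]`).**
`|S_g(x) − 2x·L_g(x) − 2·Mid_g(x)| ≤ x + 6∑_{d ≤ x} ρ_g(d)`. -/
theorem abs_polyDivisorSum_sub_main_sub_located_le (g : ℤ[X]) {x : ℕ}
    (hsq : ∀ n ∈ Icc 1 x, n * n ≤ (g.eval (n : ℤ)).natAbs) :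
    |(polyDivisorSum g x : ℝ) - 2 * (x : ℝ) * polySmallLevel g x - 2 * (polyLocatedRootCount g x : ℝ)|
      ≤ (x : ℝ) + 6 * ∑ d ∈ Icc 1 x, (polyRootCountMod ![g] d : ℝ) := by
  have hg0 : ∀ n ∈ Icc 1 x, g.eval (n : ℤ) ≠ 0 := by
    intro n hn h
    have := hsq n hn
    rw [h, Int.natAbs_zero] at this
    have h1 : 1 ≤ n := (mem_Icc.mp hn).1
    nlinarith
  have hdec := polyDivisorSum_add_two_mul_bdry_eq g x
  have hdecR : (polyDivisorSum g x : ℝ) + 2 * (polyBdryCount g x : ℝ)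
      = 2 * (polySmallStorey g x : ℝ) + 2 * (polyLocatedRootCount g x : ℝ) + (polySqCount g x : ℝ) := by
    exact_mod_cast hdec
  have hA := abs_polySmallStorey_sub_le g hg0
  have hB := polyBdryCount_le g hsq
  have hB0 : (0 : ℝ) ≤ polyBdryCount g x := Nat.cast_nonneg _
  have hSq : (polySqCount g x : ℝ) ≤ x := by exact_mod_cast polySqCount_le g x
  have hSq0 : (0 : ℝ) ≤ polySqCount g x := Nat.cast_nonneg _
  rw [abs_le] at hA ⊢
  constructor <;> nlinarith [hA.1, hA.2]

/-- **Headline (irreducible `g` of positive degree with `n² ≤ |g(n)|` for `n ≥ 1`)**: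
`S_g(x) = 2x·L_g(x) + 2·Mid_g(x) + O(x)` — the divisor sum along `g` is an explicit small-divisor term plus twice the
located root count past `x`, up to `O(x)`. -/
theorem exists_abs_polyDivisorSum_sub_le {g : ℤ[X]} (hirr : Irreducible g) (hdeg : 0 < g.natDegree)
    (hsq : ∀ n : ℕ, 1 ≤ n → n * n ≤ (g.eval (n : ℤ)).natAbs) :
    ∃ C : ℝ, ∀ x : ℕ, 2 ≤ x →
      |(polyDivisorSum g x : ℝ) - 2 * (x : ℝ) * polySmallLevel g x - 2 * (polyLocatedRootCount g x : ℝ)|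
        ≤ C * x := by
  obtain ⟨C, hC0, hC⟩ := exists_sum_rootCount_le hirr hdeg
  refine ⟨1 + 6 * C, fun x hx => ?_⟩
  have h1 := abs_polyDivisorSum_sub_main_sub_located_le g (x := x) fun n hn => hsq n (mem_Icc.mp hn).1
  have h2 := hC (x : ℝ) (by exact_mod_cast hx)
  rw [Nat.floor_natCast] at h2
  nlinarith

/-- **Corollary (the classical mean value as a hypothesis).**  If `L_g(x) = A log x + O(1)` — the Dedekind–Landau
mean value of `ρ_g`, a consequence of the prime ideal theorem, NOT proved here — then
`S_g(x) − 2·Mid_g(x) = 2A·x log x + O(x)`: an asymptotic `S_g(x) ~ D·x log x` is equivalent to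
`Mid_g(x) ~ (D/2 − A)·x log x`. -/
theorem exists_abs_polyDivisorSum_sub_located_sub_log_le {g : ℤ[X]} (hirr : Irreducible g)
    (hdeg : 0 < g.natDegree) (hsq : ∀ n : ℕ, 1 ≤ n → n * n ≤ (g.eval (n : ℤ)).natAbs)
    {A K : ℝ} (hL : ∀ x : ℕ, 2 ≤ x → |polySmallLevel g x - A * Real.log x| ≤ K) :
    ∃ C : ℝ, ∀ x : ℕ, 2 ≤ x →
      |(polyDivisorSum g x : ℝ) - 2 * (polyLocatedRootCount g x : ℝ) - 2 * A * (x : ℝ) * Real.log x|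
        ≤ C * x := by
  obtain ⟨C, hC⟩ := exists_abs_polyDivisorSum_sub_le hirr hdeg hsq
  refine ⟨C + 2 * K, fun x hx => ?_⟩
  have h1 := hC x hx
  have h2 := hL x hx
  have hx0 : (0 : ℝ) ≤ x := Nat.cast_nonneg _
  rw [abs_le] at h1 h2 ⊢
  constructor <;> nlinarith [h1.1, h1.2, h2.1, h2.2]

/-! ### Instances: `n³ + 2` (with the unconditional corollary) and `n² + 1` -/

/-- `n² ≤ |n³ + 2|` for `n ≥ 1`. -/
theorem sq_le_natAbs_eval_cubic (n : ℕ) (hn : 1 ≤ n) :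
    n * n ≤ ((X ^ 3 + C 2 : ℤ[X]).eval (n : ℤ)).natAbs := by
  have h : ((X ^ 3 + C 2 : ℤ[X]).eval (n : ℤ)) = (n : ℤ) ^ 3 + 2 := by simp
  rw [h]
  have h2 : ((n : ℤ) ^ 3 + 2).natAbs = n ^ 3 + 2 := by
    rw [show ((n : ℤ) ^ 3 + 2 : ℤ) = ((n ^ 3 + 2 : ℕ) : ℤ) by push_cast; ring, Int.natAbs_natCast]
  rw [h2]
  nlinarith

/-- **Corollary (`g = X³ + 2`, hypothesis-free)**: for `S(x) = ∑_{n ≤ x} τ(n³ + 2)`,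
`S(x) = 2x·L(x) + 2·Mid(x) + O(x)` with `L(x) = ∑_{d ≤ x} ρ(d)/d` and `Mid(x)` the located root count of `n³ + 2`
over the moduli `e ∈ (x, (n³ + 2)^{1/2})` — irreducibility is the tree's
`LargestPrimeFactorCubic.irreducible_X_pow_three_add_two` (Eisenstein at `2`). -/
theorem exists_abs_polyDivisorSum_cubic_sub_le :
    ∃ B : ℝ, ∀ x : ℕ, 2 ≤ x →
      |(polyDivisorSum (X ^ 3 + C 2) x : ℝ) - 2 * (x : ℝ) * polySmallLevel (X ^ 3 + C 2) x
          - 2 * (polyLocatedRootCount (X ^ 3 + C 2) x : ℝ)| ≤ B * x :=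
  exists_abs_polyDivisorSum_sub_le
    Literature.NumberTheory.Sieve.LargestPrimeFactorCubic.irreducible_X_pow_three_add_two
    (by rw [natDegree_X_pow_add_C]; norm_num) sq_le_natAbs_eval_cubic

/-- `n² ≤ |n² + 1|`. -/
theorem sq_le_natAbs_eval_quadratic (n : ℕ) :
    n * n ≤ ((X ^ 2 + 1 : ℤ[X]).eval (n : ℤ)).natAbs := by
  have h : ((X ^ 2 + 1 : ℤ[X]).eval (n : ℤ)) = (n : ℤ) ^ 2 + 1 := by simp
  rw [h]
  have h2 : ((n : ℤ) ^ 2 + 1).natAbs = n ^ 2 + 1 := by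
    rw [show ((n : ℤ) ^ 2 + 1 : ℤ) = ((n ^ 2 + 1 : ℕ) : ℤ) by push_cast; ring, Int.natAbs_natCast]
  rw [h2]
  nlinarith

end Summit.Parity.BatemanHorn.Theorems
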